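import Summits.Parity.GeneralizedHardyLittlewood.Theorems.LeeYangFibresFibrationLemmaTail
import Literature.NumberTheory.LFunctions.MertensElementary
import Mathlib.Analysis.SpecialFunctions.Log.Basic
import HarnessLib

/-!
# Fibration lemma (`DimOne → GeneralizedHardyLittlewood`), part 7: Mertens-type bounds for heads and tails

Support file for the statement item `FibrationLemma : DimOne → GeneralizedHardyLittlewood`
(Green–Tao 2010, §1, remark after Conj. 1.2). Quantitative bounds for the pieces of the
factorisation `∏_{p≤x} β_p = head · B · R` of part 6, from classical inputs proved in the tree
(`Literature/NumberTheory/LFunctions/MertensElementary.lean`): Mertens' product bound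
`∏_{p≤z} (1 - 1/p) ≥ e^{-5}/log z`, the totient bound `φ(n)/n ≥ e^{-5}/(2 log log n)` (`n ≥ 3⁹`).

* `headMax t z = (e⁵ log z)^t` bounds every head: `∏_{p≤z} β_p(Φ) ≤ ∏_{p≤z} (p/(p-1))^t ≤ headMax`
  (`singularProductPartial_le_headMax`);
* `totBound n = 3⁹ + 2e⁵ max(0, log log n)` bounds `n/φ(n) = ∏_{p∣n} p/(p-1)` (`prod_primeFactors_le_totBound`);
* `prod_tailPrimes_fibre_le` — for a GOOD base point `w` (all `Dᵢⱼ(w) ≠ 0`, `i ≠ j`):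
  `∏_{z<p≤x} β_p(Φ_w) ≤ totBound(M)^{t-1}`, `M = ∏_{i≠j} |Dᵢⱼ(w)|` (a large prime with all roots
  distinct has `β_p ≤ 1`; the others divide `M` and have `β_p ≤ (p/(p-1))^{t-1}`); hence
  `B ≤ 𝔅 := totBound(D_max^{t²})^{t-1}` (`tailB_le`), the head of `Ψ` is `≤ 2^{t(P₀+1)} 𝔅 e^{t²}`
  (`singularProductPartial_le_headBar`), and `𝔖(Ψ) ≤ headBar · 𝔅 · exp(2t³/z)` (`singularProduct_le`).
-/

noncomputable section

open Finset Filter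
open scoped Topology

namespace Summit.Parity.GeneralizedHardyLittlewood.Theorems

open Literature.NumberTheory.Sieve
open Literature.NumberTheory.LFunctions.MertensBound (exp_neg_div_log_le_prod_one_sub_inv
  totient_div_self_ge totient_eq_mul_prod_one_sub_inv)

variable {d t : ℕ}

/-! ### Mertens: the universal head bound -/

/-- `headMax t z = (e⁵ log z)^t`. [folklore] -/
def headMax (t z : ℕ) : ℝ := (Real.exp 5 * Real.log z) ^ t

/-- **Mertens' product bound**: `∏_{p ≤ z} p/(p-1) ≤ e⁵ log z` for `z ≥ 2`.
[cite: HardyWright2008, Thm 429 (§22.8)] -/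
theorem prod_primesLE_div_pred_le {z : ℕ} (hz : 2 ≤ z) :
    ∏ p ∈ Nat.primesLE z, (p : ℝ) / (p - 1) ≤ Real.exp 5 * Real.log z := by
  have h := exp_neg_div_log_le_prod_one_sub_inv z hz
  have hlog : 0 < Real.log z := Real.log_pos (by exact_mod_cast (by omega : 1 < z))
  have hpos : ∀ p ∈ Nat.primesLE z, 0 < 1 - 1 / (p : ℝ) := fun p hp => by
    have hp2 : (2 : ℝ) ≤ p := by exact_mod_cast (Nat.mem_primesLE.mp hp).2.two_le
    have : 1 / (p : ℝ) < 1 := by rw [div_lt_one (by linarith)]; linarith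
    linarith
  have heq : ∏ p ∈ Nat.primesLE z, (p : ℝ) / (p - 1) = (∏ p ∈ Nat.primesLE z, (1 - 1 / (p : ℝ)))⁻¹ := by
    rw [← Finset.prod_inv_distrib]
    refine Finset.prod_congr rfl fun p hp => ?_
    have hp2 : (2 : ℝ) ≤ p := by exact_mod_cast (Nat.mem_primesLE.mp hp).2.two_le
    have hp0 : (p : ℝ) ≠ 0 := by positivity
    have hp1 : (p : ℝ) - 1 ≠ 0 := by linarith
    field_simp
  rw [heq]
  have hprod : 0 < ∏ p ∈ Nat.primesLE z, (1 - 1 / (p : ℝ)) := Finset.prod_pos hpos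
  calc (∏ p ∈ Nat.primesLE z, (1 - 1 / (p : ℝ)))⁻¹ ≤ (Real.exp (-5) / Real.log z)⁻¹ :=
        inv_anti₀ (by positivity) h
    _ = Real.exp 5 * Real.log z := by rw [inv_div, Real.exp_neg]; field_simp

/-- `∏_{p≤z} (p/(p-1))^t ≤ headMax t z` for `z ≥ 2`. [cite: HardyWright2008, Thm 429 (§22.8)] -/
theorem prod_primesLE_div_pred_pow_le {z : ℕ} (hz : 2 ≤ z) (t : ℕ) :
    ∏ p ∈ Nat.primesLE z, ((p : ℝ) / (p - 1)) ^ t ≤ headMax t z := by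
  rw [Finset.prod_pow, headMax]
  refine pow_le_pow_left₀ (Finset.prod_nonneg fun p hp => ?_) (prod_primesLE_div_pred_le hz) t
  have hp2 : (2 : ℝ) ≤ p := by exact_mod_cast (Nat.mem_primesLE.mp hp).2.two_le
  exact div_nonneg (by linarith) (by linarith)

/-- **Every head is at most `headMax`**: `∏_{p≤z} β_p(Φ) ≤ (e⁵ log z)^t` for any system of `t`
forms (in any dimension) and `z ≥ 2`. [cite: GreenTao2010, proof of Lemma 1.3] -/
theorem singularProductPartial_le_headMax {e : ℕ} (Φ : Fin t → AffLinForm e) {z : ℕ} (hz : 2 ≤ z) :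
    singularProductPartial Φ z ≤ headMax t z := by
  refine le_trans ?_ (prod_primesLE_div_pred_pow_le hz t)
  unfold singularProductPartial
  exact Finset.prod_le_prod (fun p _ => localFactor_nonneg _ _)
    fun p hp => localFactor_prime_le Φ (Nat.mem_primesLE.mp hp).2

/-- `headMax ≥ 0` for `z ≥ 1`. [folklore] -/
theorem headMax_nonneg (t : ℕ) {z : ℕ} (hz : 1 ≤ z) : 0 ≤ headMax t z := by
  unfold headMax
  exact pow_nonneg (mul_nonneg (Real.exp_pos _).le (Real.log_nonneg (by exact_mod_cast hz))) t

/-- The partial singular products are non-negative. [folklore] -/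
theorem singularProductPartial_nonneg {e : ℕ} (Φ : Fin t → AffLinForm e) (z : ℕ) :
    0 ≤ singularProductPartial Φ z :=
  Finset.prod_nonneg fun _ _ => localFactor_nonneg _ _

/-! ### The totient bound -/

/-- `totBound n = 3⁹ + 2 e⁵ max(0, log log n)`. [folklore] -/
def totBound (n : ℕ) : ℝ := 3 ^ 9 + 2 * Real.exp 5 * max 0 (Real.log (Real.log n))

/-- `totBound ≥ 1`. [folklore] -/
theorem one_le_totBound (n : ℕ) : 1 ≤ totBound n := by
  unfold totBound
  have : 0 ≤ 2 * Real.exp 5 * max 0 (Real.log (Real.log n)) := by positivity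
  linarith [show (1 : ℝ) ≤ 3 ^ 9 by norm_num]

/-- `n ↦ max(0, log log n)` is monotone on `ℕ`. [folklore] -/
theorem loglog_max_mono {n m : ℕ} (h : n ≤ m) :
    max 0 (Real.log (Real.log n)) ≤ max 0 (Real.log (Real.log m)) := by
  have hn0 : 0 ≤ Real.log (n : ℝ) := by
    rcases Nat.eq_zero_or_pos n with hn | hn
    · subst hn; simp
    · exact Real.log_nonneg (by exact_mod_cast hn)
  rcases hn0.eq_or_lt with h0 | hpos
  · rw [← h0, Real.log_zero, max_self]
    exact le_max_left _ _
  · have hn1 : (1 : ℝ) < n := by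
      by_contra hc
      push Not at hc
      exact absurd (Real.log_nonpos (by positivity) hc) (not_le.mpr hpos)
    have hm : (n : ℝ) ≤ m := by exact_mod_cast h
    exact max_le_max le_rfl (Real.log_le_log hpos (Real.log_le_log (by linarith) hm))

/-- `totBound` is monotone. [folklore] -/
theorem totBound_mono {n m : ℕ} (h : n ≤ m) : totBound n ≤ totBound m := by
  unfold totBound
  have := loglog_max_mono h
  gcongr

/-- **`n/φ(n) = ∏_{p ∣ n} p/(p-1) ≤ totBound n`** for `n ≥ 1` (Landau's totient bound for
`n ≥ 3⁹`, trivial below). [cite: HardyWright2008, Thm 328 (§18.4)] -/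
theorem prod_primeFactors_le_totBound {n : ℕ} (hn : 1 ≤ n) :
    ∏ p ∈ n.primeFactors, (p : ℝ) / (p - 1) ≤ totBound n := by
  have hn0 : (0 : ℝ) < n := by exact_mod_cast hn
  -- `∏ p/(p-1) = n/φ(n)`
  have hφ := totient_eq_mul_prod_one_sub_inv n
  have hpos : ∀ p ∈ n.primeFactors, 0 < 1 - 1 / (p : ℝ) := fun p hp => by
    have hp2 : (2 : ℝ) ≤ p := by exact_mod_cast (Nat.prime_of_mem_primeFactors hp).two_le
    have : 1 / (p : ℝ) < 1 := by rw [div_lt_one (by linarith)]; linarith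
    linarith
  have hP : 0 < ∏ p ∈ n.primeFactors, (1 - 1 / (p : ℝ)) := Finset.prod_pos hpos
  have heq : ∏ p ∈ n.primeFactors, (p : ℝ) / (p - 1) = (n : ℝ) / Nat.totient n := by
    rw [hφ, ← div_div, div_self hn0.ne', one_div, ← Finset.prod_inv_distrib]
    refine Finset.prod_congr rfl fun p hp => ?_
    have hp2 : (2 : ℝ) ≤ p := by exact_mod_cast (Nat.prime_of_mem_primeFactors hp).two_le
    have hp0 : (p : ℝ) ≠ 0 := by positivity
    have hp1 : (p : ℝ) - 1 ≠ 0 := by linarith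
    field_simp
  rw [heq]
  have hφ0 : (0 : ℝ) < Nat.totient n := by exact_mod_cast Nat.totient_pos.mpr hn
  unfold totBound
  rcases lt_or_ge n (3 ^ 9) with hsmall | hbig
  · -- `n/φ(n) ≤ n < 3^9`
    have h1 : (n : ℝ) / Nat.totient n ≤ n := by
      rw [div_le_iff₀ hφ0]
      have : (1 : ℝ) ≤ Nat.totient n := by exact_mod_cast Nat.totient_pos.mpr hn
      nlinarith
    have h2 : (n : ℝ) < 3 ^ 9 := by exact_mod_cast hsmall
    have h3 : 0 ≤ 2 * Real.exp 5 * max 0 (Real.log (Real.log n)) := by positivity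
    linarith
  · have h := totient_div_self_ge n hbig
    -- `log log n ≥ log log 3^9 > 0`
    have hll : 0 < Real.log (Real.log n) := by
      have h39 : (3 : ℝ) ^ 9 ≤ n := by exact_mod_cast hbig
      have hlog3 : (9 : ℝ) ≤ Real.log n := by
        have : Real.log ((3 : ℝ) ^ 9) ≤ Real.log n := Real.log_le_log (by positivity) h39
        rw [Real.log_pow] at this
        have hl3 : (1 : ℝ) ≤ Real.log 3 := by
          rw [Real.le_log_iff_exp_le (by norm_num)]
          exact Real.exp_one_lt_three.le
        push_cast at this
        nlinarith
      exact Real.log_pos (by linarith)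
    rw [max_eq_right hll.le]
    have h1 : (n : ℝ) / Nat.totient n ≤ 2 * Real.exp 5 * Real.log (Real.log n) := by
      rw [div_le_iff₀ hφ0]
      have h2 := (div_le_div_iff₀ (by positivity) hn0).mp h
      -- `exp(-5) n ≤ φ n · 2 log log n`
      have h3 : Real.exp (-5) * Real.exp 5 = 1 := by rw [← Real.exp_add]; simp
      nlinarith [Real.exp_pos 5, Real.exp_pos (-5), h2, h3]
    linarith [show (0 : ℝ) ≤ 3 ^ 9 by positivity]

/-! ### The tail product at a good base point -/

/-- `∏_s f ≤ ∏_t f` for `s ⊆ t`, `f ≥ 0` on `s` and `f ≥ 1` on `t` (real numbers). [folklore] -/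
theorem prod_le_prod_of_subset_of_one_le_real {ι : Type*} {s u : Finset ι} {f : ι → ℝ}
    (hsu : s ⊆ u) (h0 : ∀ i ∈ s, 0 ≤ f i) (h1 : ∀ i ∈ u, 1 ≤ f i) :
    ∏ i ∈ s, f i ≤ ∏ i ∈ u, f i := by
  classical
  rw [← Finset.prod_sdiff hsu]
  have h2 : 1 ≤ ∏ i ∈ u \ s, f i :=
    one_le_prod_of_one_le _ _ fun i hi => h1 i (Finset.mem_sdiff.mp hi).1
  have h3 : 0 ≤ ∏ i ∈ s, f i := Finset.prod_nonneg h0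
  nlinarith

/-- The product of the absolute discriminants over ordered pairs `i ≠ j` (a natural number; non-zero
at a good base point). [folklore] -/
def discProd (Ψ : Fin t → AffLinForm (d + 1)) (w : Fin d → ℤ) : ℕ :=
  ∏ ij ∈ (univ : Finset (Fin t)).offDiag, ((discForm Ψ ij.1 ij.2).eval w).natAbs

/-- `discProd ≠ 0` at a good base point. [folklore] -/
theorem discProd_ne_zero {Ψ : Fin t → AffLinForm (d + 1)} {N : ℕ} {w : Fin d → ℤ} (hw : w ∈ goodSet Ψ N) :
    discProd Ψ w ≠ 0 := by
  unfold discProd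
  refine Finset.prod_ne_zero_iff.mpr fun ij hij => ?_
  exact Int.natAbs_ne_zero.mpr ((mem_goodSet.mp hw).2 ij.1 ij.2 (Finset.mem_offDiag.mp hij).2.2)

/-- `Dᵢⱼ(w) ∣ discProd` for `i ≠ j` (in `ℤ`, up to sign: `p ∣ Dᵢⱼ(w) ⟹ p ∣ discProd`). [folklore] -/
theorem dvd_discProd_of_dvd {Ψ : Fin t → AffLinForm (d + 1)} {w : Fin d → ℤ} {p : ℕ} {i j : Fin t}
    (hij : i ≠ j) (h : (p : ℤ) ∣ (discForm Ψ i j).eval w) : p ∣ discProd Ψ w := by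
  have h1 : p ∣ ((discForm Ψ i j).eval w).natAbs := Int.natCast_dvd.mp h
  have hmem : (i, j) ∈ (univ : Finset (Fin t)).offDiag :=
    Finset.mem_offDiag.mpr ⟨Finset.mem_univ i, Finset.mem_univ j, hij⟩
  have h2 := Finset.dvd_prod_of_mem (fun ij : Fin t × Fin t => ((discForm Ψ ij.1 ij.2).eval w).natAbs) hmem
  exact Nat.dvd_trans h1 h2

/-- `discProd ≤ D_max^{t²}` when all `|Dᵢⱼ(w)| ≤ D_max` (`D_max ≥ 1`). [folklore] -/
theorem discProd_le {Ψ : Fin t → AffLinForm (d + 1)} {w : Fin d → ℤ} {Dmax : ℕ} (hD : 1 ≤ Dmax)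
    (hM : ∀ i j, |(discForm Ψ i j).eval w| ≤ Dmax) : discProd Ψ w ≤ Dmax ^ (t * t) := by
  unfold discProd
  calc ∏ ij ∈ (univ : Finset (Fin t)).offDiag, ((discForm Ψ ij.1 ij.2).eval w).natAbs
      ≤ ∏ _ij ∈ (univ : Finset (Fin t)).offDiag, Dmax := by
        refine Finset.prod_le_prod' fun ij _ => ?_
        have := hM ij.1 ij.2
        rw [Int.abs_eq_natAbs] at this
        exact_mod_cast this
    _ = Dmax ^ (t * t - t) := by
        rw [Finset.prod_const, Finset.offDiag_card, Finset.card_univ, Fintype.card_fin]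
    _ ≤ Dmax ^ (t * t) := Nat.pow_le_pow_right hD (Nat.sub_le _ _)

section Good

variable {Ψ : Fin t → AffLinForm (d + 1)} {L N z : ℕ}

/-- **The tail product at a good base point**: `∏_{z<p≤x} β_p(Φ_w) ≤ totBound(discProd w)^{t-1}`
for `w ∈ goodSet` and `z` beyond the threshold. [cite: GreenTao2010, proof of Lemma 1.3] -/
theorem prod_tailPrimes_fibre_le (hL : ∀ i j, ((Ψ i).coeff j).natAbs ≤ L) (ha : ∀ i, lastCoeff (Ψ i) ≠ 0)
    (ht : 1 ≤ t) (hz : tailThreshold t L ≤ z) (x : ℕ) {w : Fin d → ℤ} (hw : w ∈ goodSet Ψ N) :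
    ∏ p ∈ tailPrimes z x, localFactor (fibreSystem Ψ w) p ≤ totBound (discProd Ψ w) ^ (t - 1) := by
  classical
  set M := discProd Ψ w with hMdef
  have hM0 : M ≠ 0 := discProd_ne_zero hw
  have hL1 := one_le_of_coeff_bound hL ha ht
  -- pointwise: `β_p ≤ g p := if p ∣ M then (p/(p-1))^{t-1} else 1`
  set g : ℕ → ℝ := fun p => if p ∣ M then ((p : ℝ) / (p - 1)) ^ (t - 1) else 1 with hg
  have hpt : ∀ p ∈ tailPrimes z x, localFactor (fibreSystem Ψ w) p ≤ g p := by
    intro p hp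
    obtain ⟨hprime, hpL, hpt⟩ := large_of_mem_tailPrimes hz hp
    haveI := Fact.mk hprime
    have hcast := fibreCoeff_cast_ne_zero hL ha (lt_of_two_mul_sq_lt hL1 hpL) w
    by_cases hdiv : p ∣ M
    · rw [hg]; simp only [if_pos hdiv]
      exact localFactor_dimOne_le_pow_pred _ hcast ht
    · rw [hg]; simp only [if_neg hdiv]
      refine localFactor_dimOne_le_one _ hcast fun i j hij hdvd => hdiv ?_
      rw [disc_fibreSystem] at hdvd
      exact dvd_discProd_of_dvd hij hdvd
  have hg1 : ∀ p, p.Prime → 1 ≤ g p := fun p hp => by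
    simp only [hg]
    split_ifs
    · have hp2 : (2 : ℝ) ≤ p := by exact_mod_cast hp.two_le
      exact one_le_pow₀ ((one_le_div (by linarith)).mpr (by linarith))
    · exact le_rfl
  calc ∏ p ∈ tailPrimes z x, localFactor (fibreSystem Ψ w) p ≤ ∏ p ∈ tailPrimes z x, g p :=
        Finset.prod_le_prod (fun p _ => localFactor_nonneg _ _) hpt
    _ = ∏ p ∈ (tailPrimes z x).filter (fun p => p ∣ M), ((p : ℝ) / (p - 1)) ^ (t - 1) := by
        rw [Finset.prod_filter]
    _ ≤ ∏ p ∈ M.primeFactors, ((p : ℝ) / (p - 1)) ^ (t - 1) := by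
        refine prod_le_prod_of_subset_of_one_le_real (fun p hp => ?_) (fun p hp => ?_) fun p hp => ?_
        · obtain ⟨hp1, hp2⟩ := Finset.mem_filter.mp hp
          exact Nat.mem_primeFactors.mpr ⟨(mem_tailPrimes.mp hp1).1, hp2, hM0⟩
        · have hp2 : (2 : ℝ) ≤ p := by
            exact_mod_cast (mem_tailPrimes.mp (Finset.mem_filter.mp hp).1).1.two_le
          exact pow_nonneg (div_nonneg (by linarith) (by linarith)) _
        · have hp2 : (2 : ℝ) ≤ p := by exact_mod_cast (Nat.prime_of_mem_primeFactors hp).two_le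
          exact one_le_pow₀ ((one_le_div (by linarith)).mpr (by linarith))
    _ = (∏ p ∈ M.primeFactors, (p : ℝ) / (p - 1)) ^ (t - 1) := by rw [Finset.prod_pow]
    _ ≤ totBound M ^ (t - 1) := by
        refine pow_le_pow_left₀ (Finset.prod_nonneg fun p hp => ?_)
          (prod_primeFactors_le_totBound (Nat.pos_of_ne_zero hM0)) _
        have hp2 : (2 : ℝ) ≤ p := by exact_mod_cast (Nat.prime_of_mem_primeFactors hp).two_le
        exact div_nonneg (by linarith) (by linarith)

/-- `𝔅 = totBound(D_max^{t²})^{t-1}`, the uniform bound for `B` and for the tails at good points.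
[folklore] -/
def tailBound (t Dmax : ℕ) : ℝ := totBound (Dmax ^ (t * t)) ^ (t - 1)

/-- `tailBound ≥ 1`. [folklore] -/
theorem one_le_tailBound (t Dmax : ℕ) : 1 ≤ tailBound t Dmax :=
  one_le_pow₀ (one_le_totBound _)

/-- The tail at a good point is at most `𝔅` when `|Dᵢⱼ(w)| ≤ D_max`. [folklore] -/
theorem prod_tailPrimes_fibre_le_tailBound (hL : ∀ i j, ((Ψ i).coeff j).natAbs ≤ L)
    (ha : ∀ i, lastCoeff (Ψ i) ≠ 0) (ht : 1 ≤ t) (hz : tailThreshold t L ≤ z) (x : ℕ)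
    {w : Fin d → ℤ} (hw : w ∈ goodSet Ψ N) {Dmax : ℕ} (hD : 1 ≤ Dmax)
    (hM : ∀ i j, |(discForm Ψ i j).eval w| ≤ Dmax) :
    ∏ p ∈ tailPrimes z x, localFactor (fibreSystem Ψ w) p ≤ tailBound t Dmax :=
  (prod_tailPrimes_fibre_le hL ha ht hz x hw).trans
    (pow_le_pow_left₀ (zero_le_one.trans (one_le_totBound _)) (totBound_mono (discProd_le hD hM)) _)

/-- **`B ≤ 𝔅`**: `tailB z x ≤ totBound(D_max^{t²})^{t-1}` as soon as ONE good base point with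
discriminants bounded by `D_max` exists. [cite: GreenTao2010, §1 (remark after Conj. 1.2)] -/
theorem tailB_le (hL : ∀ i j, ((Ψ i).coeff j).natAbs ≤ L) (ha : ∀ i, lastCoeff (Ψ i) ≠ 0)
    (ht : 1 ≤ t) (hz : tailThreshold t L ≤ z) (x : ℕ) {w : Fin d → ℤ} (hw : w ∈ goodSet Ψ N)
    {Dmax : ℕ} (hD : 1 ≤ Dmax) (hM : ∀ i j, |(discForm Ψ i j).eval w| ≤ Dmax) :
    tailB Ψ z x ≤ tailBound t Dmax := by
  refine le_trans ?_ (prod_tailPrimes_fibre_le_tailBound hL ha ht hz x hw hD hM)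
  unfold tailB
  refine Finset.prod_le_prod (fun p _ => localFactor_nonneg _ _) fun p hp => ?_
  haveI := Fact.mk (large_of_mem_tailPrimes hz hp).1
  exact minFactor_le Ψ w

/-! ### The head of `Ψ` -/

/-- `headBar t L Dmax = 2^{t (P₀ + 1)} · 𝔅 · e^{t²}`, `P₀ = tailThreshold t L`. [folklore] -/
def headBar (t L Dmax : ℕ) : ℝ :=
  (2 : ℝ) ^ (t * (tailThreshold t L + 1)) * tailBound t Dmax * Real.exp ((t : ℝ) ^ 2)

/-- A product of `t`-th powers of `p/(p-1)` over `p ≤ P` is at most `2^{t(P+1)}`. [folklore] -/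
theorem singularProductPartial_le_two_pow {e : ℕ} (Φ : Fin t → AffLinForm e) (P : ℕ) :
    singularProductPartial Φ P ≤ (2 : ℝ) ^ (t * (P + 1)) := by
  unfold singularProductPartial
  calc ∏ p ∈ Nat.primesLE P, localFactor Φ p ≤ ∏ p ∈ Nat.primesLE P, (2 : ℝ) ^ t :=
        Finset.prod_le_prod (fun p _ => localFactor_nonneg _ _) fun p hp =>
          (localFactor_prime_le Φ (Nat.mem_primesLE.mp hp).2).trans
            (div_pred_pow_le_two_pow (Nat.mem_primesLE.mp hp).2.two_le t)
    _ = (2 : ℝ) ^ (t * #(Nat.primesLE P)) := by rw [Finset.prod_const, ← pow_mul]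
    _ ≤ (2 : ℝ) ^ (t * (P + 1)) := by
        refine pow_le_pow_right₀ (by norm_num) (Nat.mul_le_mul_left t ?_)
        calc #(Nat.primesLE P) ≤ #(Finset.range (P + 1)) := by
              rw [Nat.primesLE_eq_filter_range]; exact Finset.card_filter_le _ _
          _ = P + 1 := Finset.card_range _

/-- **The head of `Ψ` is bounded**: `∏_{p ≤ z} β_p(Ψ) ≤ headBar` for `z ≥ P₀`, `d ≥ 1`, given a good
base point with discriminants `≤ D_max`. [cite: GreenTao2010, §1 (remark after Conj. 1.2)] -/
theorem singularProductPartial_le_headBar (hd : 1 ≤ d) (hL : ∀ i j, ((Ψ i).coeff j).natAbs ≤ L)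
    (ha : ∀ i, lastCoeff (Ψ i) ≠ 0) (ht : 1 ≤ t) (hz : tailThreshold t L ≤ z) {w : Fin d → ℤ}
    (hw : w ∈ goodSet Ψ N) {Dmax : ℕ} (hD : 1 ≤ Dmax) (hM : ∀ i j, |(discForm Ψ i j).eval w| ≤ Dmax) :
    singularProductPartial Ψ z ≤ headBar t L Dmax := by
  set P := tailThreshold t L with hP
  have hP1 : 1 ≤ P := by rw [hP, tailThreshold]; omega
  rw [singularProductPartial_split hL ha ht (le_refl P) hz, headBar]
  have h1 := singularProductPartial_le_two_pow Ψ P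
  have h2 := tailB_le hL ha ht (le_refl P) z hw hD hM
  have h3 : tailRbar Ψ P z ≤ Real.exp ((t : ℝ) ^ 2) := by
    refine (tailRbar_le_exp hd hL ha ht (le_refl P) hP1 z).trans ?_
    rw [Real.exp_le_exp]
    have hP2 : (2 * t : ℝ) ≤ P := by
      rw [hP, tailThreshold]; push_cast; nlinarith
    have ht0 : (0 : ℝ) < t := by exact_mod_cast ht
    rw [div_le_iff₀ (by linarith)]
    nlinarith
  have hB1 : 0 ≤ tailBound t Dmax := zero_le_one.trans (one_le_tailBound _ _)
  exact mul_le_mul (mul_le_mul h1 h2 (tailB_nonneg _ _ _) (by positivity)) h3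
    (Finset.prod_nonneg fun p hp => div_nonneg (localFactor_nonneg _ _)
      (minFactor_pos_of_mem hL ha ht (le_refl P) hp).le) (mul_nonneg (by positivity) hB1)

/-- `headBar ≥ 0`. [folklore] -/
theorem headBar_nonneg (t L Dmax : ℕ) : 0 ≤ headBar t L Dmax := by
  unfold headBar
  have := one_le_tailBound t Dmax
  positivity

/-- **The partial singular products of `Ψ` are uniformly bounded beyond `z`**:
`∏_{p≤x} β_p(Ψ) ≤ headBar · 𝔅 · exp(2t³/z)` for `x ≥ z ≥ P₀`. [cite: GreenTao2010, Lemma 1.3] -/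
theorem singularProductPartial_le_of_le (hd : 1 ≤ d) (hL : ∀ i j, ((Ψ i).coeff j).natAbs ≤ L)
    (ha : ∀ i, lastCoeff (Ψ i) ≠ 0) (ht : 1 ≤ t) (hz : tailThreshold t L ≤ z) (hz1 : 1 ≤ z)
    {w : Fin d → ℤ} (hw : w ∈ goodSet Ψ N) {Dmax : ℕ} (hD : 1 ≤ Dmax)
    (hM : ∀ i j, |(discForm Ψ i j).eval w| ≤ Dmax) {x : ℕ} (hzx : z ≤ x) :
    singularProductPartial Ψ x ≤ headBar t L Dmax * tailBound t Dmax * Real.exp (2 * (t : ℝ) ^ 3 / z) := by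
  rw [singularProductPartial_split hL ha ht hz hzx]
  exact mul_le_mul (mul_le_mul (singularProductPartial_le_headBar hd hL ha ht hz hw hD hM)
    (tailB_le hL ha ht hz x hw hD hM) (tailB_nonneg _ _ _) (headBar_nonneg _ _ _))
    (tailRbar_le_exp hd hL ha ht hz hz1 x) (Finset.prod_nonneg fun p hp =>
      div_nonneg (localFactor_nonneg _ _) (minFactor_pos_of_mem hL ha ht hz hp).le) (by
        have := one_le_tailBound t Dmax; have := headBar_nonneg t L Dmax; positivity)

/-- **`𝔖(Ψ) ≤ headBar · 𝔅 · exp(2t³/z)`** for a non-degenerate `Ψ` (the limit of the previous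
bound). [cite: GreenTao2010, Lemma 1.3] -/
theorem singularProduct_le (hΨ : IsNondegenerateSystem Ψ) (hd : 1 ≤ d)
    (hL : ∀ i j, ((Ψ i).coeff j).natAbs ≤ L) (ha : ∀ i, lastCoeff (Ψ i) ≠ 0) (ht : 1 ≤ t)
    (hz : tailThreshold t L ≤ z) (hz1 : 1 ≤ z) {w : Fin d → ℤ} (hw : w ∈ goodSet Ψ N) {Dmax : ℕ}
    (hD : 1 ≤ Dmax) (hM : ∀ i j, |(discForm Ψ i j).eval w| ≤ Dmax) :
    singularProduct Ψ ≤ headBar t L Dmax * tailBound t Dmax * Real.exp (2 * (t : ℝ) ^ 3 / z) := by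
  have hT := tendsto_singularProductPartial_holds _ _ Ψ hΨ
  refine le_of_tendsto hT ?_
  filter_upwards [eventually_ge_atTop z] with x hx
  exact singularProductPartial_le_of_le hd hL ha ht hz hz1 hw hD hM hx

end Good

end Summit.Parity.GeneralizedHardyLittlewood.Theorems
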